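import Summits.HodgeConjecture.CorCM.IrreducibleOddWeightsIsotypicExistenceCMFields
import HarnessLib

/-!
# Isotypic cells, existence V: THE DIMENSION OF THE HODGE GROUP OF A PRODUCT OF CM ABELIAN VARIETIES IS A SUB-SUM
# OF THE ISOTYPIC DIMENSION COUNT — `|Hom(K_i, ℂ)| = Σ_c m_{i,c}·dim A_c`, `dim Hg(∏_i A_i) = Σ_c r_c·dim A_c`,
# `dim Hg(A_i) = Σ_c r^i_c·dim A_c` with `r^i_c ≤ m_{i,c}`, `r_c ≤ Σ_i m_{i,c}`

COR-CM (cell `pub-hodgecm2`, binder seat `b16` gen 76, count-neutral claim THE ISOTYPIC DECOMPOSITION EXISTS, file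
E5 — abstract `G`-set level, type ranks and the CM dress; theorems only, no definition, no named fact, no `sorry`).
NEW as stated, hence under `Summits/`.  HONEST FRAMING: consequences of the master theorem E3
(`exists_isotypic_decomposition`) and gen 75's M5 that need NO commutant, NO components and NO census input in
their statement: only the pairwise non-isomorphic irreducible constituents `A_c` of the permutation modules
`ℚ^{E_i}`, their multiplicities `m_{i,c}` (so `ℚ^{E_i} ≅ ⊕_c A_c^{m_{i,c}}` equivariantly) and sub-multiplicities
`r`.  `rank − 1 = dim Hg` is the tree's dictionary; nothing about Hodge classes is asserted; `HC_CM` is neither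
used nor asserted.

* §1 `finrank_map_eq_of_injOn` (an embedding preserves dimension), `injOn_of_jointly_independent` (joint
  independence of `(ι_j)_j` on `A` gives injectivity of each `ι_j` on `A`), `map_stable_irreducible_of_equivariant`
  (the image of a stable irreducible under an equivariant map is stable irreducible — gen 70 `map_irreducible_of_
  intertwine` in the translate currency).
* §2 **THE ISOTYPIC DIMENSION COUNT** (`card_eq_sum_card_mul_finrank`): embeddings `ι_{c,j} : ℚ^{Y_c} → ℚ^{Y₀}`
  injective on `A_c` whose images are INDEPENDENT and SPAN `ℚ^{Y₀}` ⟹ **`|Y₀| = Σ_c |J_c|·dim A_c`**.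
* §3 **HODGE DIMENSIONS AS SUB-SUMS OF THE ISOTYPIC COUNT** (`exists_constituents_typeRank_eq_sum`): for every family
  of CM types `Φ_i ⊆ E_i` there are pairwise non-embeddable stable irreducible non-zero `A_c ≤ ℚ^{⊔_i E_i}`
  (`c ∈ Fin n`), multiplicities `m_{i,c}` with equivariant embeddings `ι^i_{c,j}` (`j < m_{i,c}`) injective on `A_c`
  whose images are independent and span `ℚ^{E_i}` — so **`|E_i| = Σ_c m_{i,c}·dim A_c`** — and integers
  **`r_c ≤ Σ_i m_{i,c}`, `r^i_c ≤ m_{i,c}`** with **`rank Σ − 1 = Σ_c r_c·dim A_c`** and **`rank Φ_i − 1 =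
  Σ_c r^i_c·dim A_c`** for every `i` (E3 + M5: `r_c`, `r^i_c` are the `𝒟_c`-ranks of the components).
* §4 CM FIELDS (`exists_constituents_cmFamilyRank_eq_sum`): the same for `dim MT(∏_i A_i) = cmFamilyRank Φ` and
  `dim MT(A_i) = cmTypeRank Φ_i`, `E_i = Hom(K_i, ℂ)`, `G = Aut(ℂ)`: **`[K_i : ℚ] = Σ_c m_{i,c}·dim A_c`,
  `dim Hg(∏_i A_i) = Σ_c r_c·dim A_c`, `dim Hg(A_i) = Σ_c r^i_c·dim A_c`**.

## References

* [Deligne1982HodgeCycles] P. Deligne, *Hodge cycles on abelian varieties*, LNM 900 (1982), I.3.4, I.5 (p. 53),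
  I Ex. 3.7 (c).
* [Serre1977] J.-P. Serre, *Linear Representations of Finite Groups*, GTM 42, §1.4 Thm. 2, §2.2, §2.6 (canonical
  decomposition; multiplicities).
* [Mai1989] L. Mai, *Lower bounds for the ranks of CM types*, J. Number Theory 32 (1989), §2 Prop. 1 (proof:
  `rank = Σ_π d_π rank(π(τ))`).
* [Lang2002] S. Lang, *Algebra*, 3rd ed., XVII §1–§3.
-/

set_option autoImplicit false

noncomputable section

open scoped BigOperators Classical

universe u uC uJ v v' vA vC w

namespace Summit.HodgeConjecture.CorCM.IrrOdd

open Literature.NumberTheory.ComplexMultiplication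

variable {G : Type w} [Group G]

/-! ### §1 Embeddings preserve dimension; joint independence gives injectivity; images are irreducible -/

section Abstract

variable {Y₀ : Type v'} [MulAction G Y₀] {YA : Type vA} [MulAction G YA]

omit [Group G] [MulAction G Y₀] [MulAction G YA] in
/-- A linear map injective on `A` preserves its dimension: `dim θ(A) = dim A`. [folklore] -/
theorem finrank_map_eq_of_injOn (θ : (YA → ℚ) →ₗ[ℚ] (Y₀ → ℚ)) (A : Submodule ℚ (YA → ℚ))
    (hinj : ∀ a ∈ A, θ a = 0 → a = 0) : Module.finrank ℚ (A.map θ) = Module.finrank ℚ A := by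
  have hi : Function.Injective (θ ∘ₗ A.subtype) := by
    intro x y hxy
    apply Subtype.ext
    have h0 : θ ((x : YA → ℚ) - y) = 0 := by
      rw [map_sub, sub_eq_zero]
      exact hxy
    exact sub_eq_zero.1 (hinj _ (A.sub_mem x.2 y.2) h0)
  have h := LinearMap.finrank_range_of_inj hi
  rwa [LinearMap.range_comp, Submodule.range_subtype] at h

omit [Group G] [MulAction G Y₀] [MulAction G YA] in
/-- **JOINT INDEPENDENCE GIVES INJECTIVITY**: if `Σ_j ι_j(f_j) = 0` with all `f_j ∈ A` forces all `f_j = 0`, then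
every `ι_j` is injective on `A` (test with `f = single_j a`). [folklore] -/
theorem injOn_of_jointly_independent {J : Type uJ} [Fintype J] {A : Submodule ℚ (YA → ℚ)}
    (ι : J → ((YA → ℚ) →ₗ[ℚ] (Y₀ → ℚ)))
    (hind : ∀ f : J → (YA → ℚ), (∀ j, f j ∈ A) → ∑ j, ι j (f j) = 0 → ∀ j, f j = 0)
    (j : J) (a : YA → ℚ) (ha : a ∈ A) (h0 : ι j a = 0) : a = 0 := by
  have hmem : ∀ j', (Pi.single j a : J → (YA → ℚ)) j' ∈ A := fun j' => by
    by_cases hj : j' = j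
    · subst hj
      rw [Pi.single_eq_same]
      exact ha
    · rw [Pi.single_eq_of_ne hj]
      exact A.zero_mem
  have hsum : ∑ j', ι j' ((Pi.single j a : J → (YA → ℚ)) j') = 0 := by
    rw [Finset.sum_eq_single j (fun j' _ hj => by rw [Pi.single_eq_of_ne hj, map_zero])
      (fun h => absurd (Finset.mem_univ j) h), Pi.single_eq_same, h0]
  have h := hind _ hmem hsum j
  rwa [Pi.single_eq_same] at h

/-- **THE IMAGE OF A STABLE IRREDUCIBLE UNDER AN EQUIVARIANT MAP IS STABLE IRREDUCIBLE** (translate currency; gen 70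
`map_irreducible_of_intertwine`). [cite: Serre1977, §2.2] -/
theorem map_stable_irreducible_of_equivariant (θ : (YA → ℚ) →ₗ[ℚ] (Y₀ → ℚ)) {A : Submodule ℚ (YA → ℚ)}
    (hAst : ∀ (k : G) (a : YA → ℚ), a ∈ A → (fun y => a (k • y)) ∈ A)
    (hAirr : ∀ W : Submodule ℚ (YA → ℚ), W ≤ A → W ≠ ⊥ →
      (∀ (k : G) (f : YA → ℚ), f ∈ W → (fun y => f (k • y)) ∈ W) → W = A)
    (hθeq : ∀ (k : G) (a : YA → ℚ), a ∈ A → θ (fun y => a (k • y)) = fun y => θ a (k • y)) :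
    (∀ (k : G) (v : Y₀ → ℚ), v ∈ A.map θ → (fun y => v (k • y)) ∈ A.map θ) ∧
      ∀ W : Submodule ℚ (Y₀ → ℚ), W ≤ A.map θ → W ≠ ⊥ →
        (∀ (k : G) (f : Y₀ → ℚ), f ∈ W → (fun y => f (k • y)) ∈ W) → W = A.map θ :=
  map_irreducible_of_intertwine (fun k : G => LinearMap.funLeft ℚ ℚ fun y : YA => k • y)
    (fun k : G => LinearMap.funLeft ℚ ℚ fun y : Y₀ => k • y) θ hAst hAirr hθeq

/-! ### §2 The isotypic dimension count -/

variable [Fintype Y₀] {C : Type uC} [Fintype C] {Yc : C → Type vC} [∀ c, MulAction G (Yc c)]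
  [∀ c, Fintype (Yc c)] {Ar : ∀ c, Submodule ℚ (Yc c → ℚ)} {JJ : C → Type uJ} [∀ c, Fintype (JJ c)]

omit [Group G] [MulAction G Y₀] [∀ c, MulAction G (Yc c)] [∀ c, Fintype (Yc c)] in
/-- **THE ISOTYPIC DIMENSION COUNT: `|Y₀| = Σ_c |J_c|·dim A_c`** when the embeddings `ι_{c,j} : ℚ^{Y_c} → ℚ^{Y₀}`
are injective on `A_c` and their images `ι_{c,j}(A_c)` form an INDEPENDENT family spanning `ℚ^{Y₀}`.
[cite: Serre1977, §2.6] [cite: Lang2002, XVII §2] -/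
theorem card_eq_sum_card_mul_finrank (ι : ∀ c, JJ c → ((Yc c → ℚ) →ₗ[ℚ] (Y₀ → ℚ)))
    (hinj : ∀ c (j : JJ c) (a : Yc c → ℚ), a ∈ Ar c → ι c j a = 0 → a = 0)
    (hind : iSupIndep fun q : (Σ c, JJ c) => (Ar q.1).map (ι q.1 q.2))
    (htop : (⨆ c, ⨆ j, (Ar c).map (ι c j)) = ⊤) :
    Fintype.card Y₀ = ∑ c, Fintype.card (JJ c) * Module.finrank ℚ (Ar c) := by
  have h := (finrank_iSup_eq_sum_finrank_iff_iSupIndep fun q : (Σ c, JJ c) => (Ar q.1).map (ι q.1 q.2)).2 hind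
  rw [iSup_sigma, htop, finrank_top, Module.finrank_fintype_fun_eq_card, Fintype.sum_sigma] at h
  rw [h]
  refine Finset.sum_congr rfl fun c _ => ?_
  rw [Finset.sum_congr rfl fun j _ => finrank_map_eq_of_injOn (ι c j) (Ar c) (hinj c j), Finset.sum_const,
    Finset.card_univ, smul_eq_mul]

end Abstract

/-! ### §3 Hodge dimensions as sub-sums of the isotypic count -/

variable {I : Type u} {E : I → Type v} [∀ i, MulAction G (E i)] [∀ i, Fintype (E i)] [Fintype I]
  [∀ i, Nonempty (E i)]

/-- **HODGE DIMENSIONS AS SUB-SUMS OF THE ISOTYPIC DIMENSION COUNT.**  For every family of CM types `Φ_i ⊆ E_i`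
(`i ∈ I` finite, non-empty) there are pairwise non-embeddable, stable, irreducible, non-zero `A_c ≤ ℚ^{⊔_i E_i}`
(`c ∈ Fin n`) and multiplicities `m_{i,c}` with equivariant embeddings `ι^i_{c,j} : ℚ^{⊔E} → ℚ^{E_i}`
(`j ∈ Fin m_{i,c}`) injective on `A_c` whose images are independent and span `ℚ^{E_i}` — so `ℚ^{E_i} ≅
⊕_c A_c^{m_{i,c}}` and **`|E_i| = Σ_c m_{i,c}·dim A_c`** — together with integers **`r_c ≤ Σ_i m_{i,c}`** and
**`r^i_c ≤ m_{i,c}`** such that **`rank Σ = Σ_c r_c·dim A_c + 1`** (`dim Hg(∏_i A_i) = Σ_c r_c·dim A_c`) and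
**`rank Φ_i = Σ_c r^i_c·dim A_c + 1`** for every `i` (`dim Hg(A_i) = Σ_c r^i_c·dim A_c`).  (`r_c`, `r^i_c` are the
`𝒟_c`-ranks of the class-`c` components of the type vectors, file E4 / gen 75 M5.)
[cite: Deligne1982HodgeCycles, I.3.4, I.5 (p. 53) and I Ex. 3.7 (c)] [cite: Serre1977, §2.6]
[cite: Mai1989, §2 Prop. 1 (proof)] -/
theorem exists_constituents_typeRank_eq_sum [Nonempty I] {ρ : G} {Φ : ∀ i, Set (E i)}
    (h : ∀ i, IsCMTypeWith ρ (Φ i)) :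
    ∃ (n : ℕ) (Ar : Fin n → Submodule ℚ ((Σ i, E i) → ℚ)) (m : I → Fin n → ℕ)
      (ι : ∀ (i : I) (c : Fin n), Fin (m i c) → (((Σ i, E i) → ℚ) →ₗ[ℚ] (E i → ℚ)))
      (r : Fin n → ℕ) (ri : I → Fin n → ℕ),
      (∀ (c : Fin n) (k : G) (a : (Σ i, E i) → ℚ), a ∈ Ar c → (fun x => a (k • x)) ∈ Ar c) ∧
      (∀ (c : Fin n) (W : Submodule ℚ ((Σ i, E i) → ℚ)), W ≤ Ar c → W ≠ ⊥ →
        (∀ (k : G) (f : (Σ i, E i) → ℚ), f ∈ W → (fun x => f (k • x)) ∈ W) → W = Ar c) ∧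
      (∀ c : Fin n, Ar c ≠ ⊥) ∧
      (∀ (c c' : Fin n) (L : ((Σ i, E i) → ℚ) →ₗ[ℚ] ((Σ i, E i) → ℚ)), c ≠ c' → Ar c ≠ ⊥ →
        (∀ a ∈ Ar c, L a ∈ Ar c') → (∀ a ∈ Ar c, L a = 0 → a = 0) →
        (∀ (k : G) (a : (Σ i, E i) → ℚ), a ∈ Ar c → L (fun x => a (k • x)) = fun x => L a (k • x)) →
        False) ∧
      (∀ (i : I) (c : Fin n) (j : Fin (m i c)) (k : G) (a : (Σ i, E i) → ℚ), a ∈ Ar c →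
        ι i c j (fun x => a (k • x)) = fun s => ι i c j a (k • s)) ∧
      (∀ (i : I) (c : Fin n) (j : Fin (m i c)) (a : (Σ i, E i) → ℚ), a ∈ Ar c → ι i c j a = 0 → a = 0) ∧
      (∀ i : I, iSupIndep fun q : (Σ c : Fin n, Fin (m i c)) => (Ar q.1).map (ι i q.1 q.2)) ∧
      (∀ i : I, (⨆ c : Fin n, ⨆ j : Fin (m i c), (Ar c).map (ι i c j)) = ⊤) ∧
      (∀ i : I, Fintype.card (E i) = ∑ c, m i c * Module.finrank ℚ (Ar c)) ∧
      (∀ c, r c ≤ ∑ i, m i c) ∧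
      typeRank G (sigmaType Φ) = (∑ c, r c * Module.finrank ℚ (Ar c)) + 1 ∧
      (∀ i c, ri i c ≤ m i c) ∧
      ∀ i, typeRank G (Φ i) = (∑ c, ri i c * Module.finrank ℚ (Ar c)) + 1 := by
  obtain ⟨n, Ar, m, ι, hRst, hRirr, hR0, hsep, hιeq, hind, hindep, htop, hdec⟩ :=
    exists_isotypic_decomposition (G := G) (E := E)
  obtain ⟨𝒟, h𝒟⟩ := exists_commutants (G := G) Ar
  obtain ⟨a₀, ha₀, h0⟩ := exists_mem_ne_zero_of_forall_ne_bot hR0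
  obtain ⟨b, hb, hu⟩ := hdec fun i => antiVec (Φ i) (1 : G)
  have hinj : ∀ (i : I) (c : Fin n) (j : Fin (m i c)) (a : (Σ i, E i) → ℚ), a ∈ Ar c → ι i c j a = 0 → a = 0 :=
    fun i c j a ha h0 => injOn_of_jointly_independent (ι i c) (hind i c) j a ha h0
  -- the family formula and the member formulas (gen 75 M5)
  obtain ⟨r, hr, -, hS⟩ := exists_rank_typeRank_sigmaType_eq_sum_of_classes (Yc := fun _ : Fin n => Σ i, E i)
    (JJ := fun i c => Fin (m i c)) h h𝒟 hRst hRirr hsep ι hιeq hind hb hu ha₀ h0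
  have hmem : ∀ i, ∃ ri : Fin n → ℕ, (∀ c, ri c ≤ m i c) ∧
      typeRank G (Φ i) = (∑ c, ri c * Module.finrank ℚ (Ar c)) + 1 := by
    intro i
    obtain ⟨ri, hri, -, hSi⟩ := exists_rank_typeRank_eq_sum_of_classes (Yc := fun _ : Fin n => Σ i, E i)
      (JJ := fun i c => Fin (m i c)) h i h𝒟 hRst hRirr hsep ι hιeq hind hb hu ha₀ h0
    refine ⟨ri, fun c => ?_, hSi⟩
    have h1 := hri c
    simp only [Fintype.card_fin] at h1
    exact h1
  choose ri hri hSi using hmem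
  refine ⟨n, Ar, m, ι, r, ri, hRst, hRirr, hR0, hsep, hιeq, hinj, hindep, htop, fun i => ?_, fun c => ?_, hS,
    hri, hSi⟩
  · have h1 := card_eq_sum_card_mul_finrank (Ar := Ar) (ι i) (hinj i) (hindep i) (htop i)
    simp only [Fintype.card_fin] at h1
    exact h1
  · have h1 := hr c
    simp only [Fintype.card_fin] at h1
    exact h1

/-- **COROLLARY: `rank Σ − 1 ≤ Σ_c (Σ_i m_{i,c})·dim A_c = Σ_i |E_i|` and `rank Φ_i − 1 ≤ |E_i|` are the trivial
bounds; the content of §3 is WHICH sub-sums occur.  Here: the sum of the member defects `Σ_i (rank Φ_i − 1) −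
(rank Σ − 1)` is itself a combination `Σ_c (Σ_i r^i_c − r_c)·dim A_c` of the constituent dimensions with
`r_c ≤ Σ_i r^i_c`** (sub-additivity of the `𝒟_c`-rank over the members, class by class: `dim ⨆_i X_i ≤ Σ_i dim X_i`
for the D-spans). [cite: Deligne1982HodgeCycles, I.5 (p. 53)] [cite: Lang2002, XVII §3] -/
theorem exists_constituents_defect_eq_sum [Nonempty I] {ρ : G} {Φ : ∀ i, Set (E i)}
    (h : ∀ i, IsCMTypeWith ρ (Φ i)) :
    ∃ (n : ℕ) (d : Fin n → ℕ) (r : Fin n → ℕ) (ri : I → Fin n → ℕ),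
      (∀ c, 0 < d c) ∧ (∀ c, r c ≤ ∑ i, ri i c) ∧
      typeRank G (sigmaType Φ) = (∑ c, r c * d c) + 1 ∧
      (∀ i, typeRank G (Φ i) = (∑ c, ri i c * d c) + 1) ∧
      (∑ i, typeRank G (Φ i)) + 1 = typeRank G (sigmaType Φ) + Fintype.card I +
        ∑ c, ((∑ i, ri i c) - r c) * d c := by
  obtain ⟨n, Ar, m, ι, hRst, hRirr, hR0, hsep, hιeq, hind, -, -, hdec⟩ :=
    exists_isotypic_decomposition (G := G) (E := E)
  obtain ⟨𝒟, h𝒟⟩ := exists_commutants (G := G) Ar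
  obtain ⟨a₀, ha₀, h0⟩ := exists_mem_ne_zero_of_forall_ne_bot hR0
  obtain ⟨b, hb, hu⟩ := hdec fun i => antiVec (Φ i) (1 : G)
  obtain ⟨r, -, hD, hS⟩ := exists_rank_typeRank_sigmaType_eq_sum_of_classes (Yc := fun _ : Fin n => Σ i, E i)
    (JJ := fun i c => Fin (m i c)) h h𝒟 hRst hRirr hsep ι hιeq hind hb hu ha₀ h0
  have hmem : ∀ i, ∃ ri : Fin n → ℕ,
      (∀ c, Module.finrank ℚ ↥(⨆ j, (𝒟 c).map (LinearMap.applyₗ (b i c j))) =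
        ri c * Module.finrank ℚ ↥((𝒟 c).map (LinearMap.applyₗ (a₀ c)))) ∧
      typeRank G (Φ i) = (∑ c, ri c * Module.finrank ℚ (Ar c)) + 1 := fun i => by
    obtain ⟨ri, -, hDi, hSi⟩ := exists_rank_typeRank_eq_sum_of_classes (Yc := fun _ : Fin n => Σ i, E i)
      (JJ := fun i c => Fin (m i c)) h i h𝒟 hRst hRirr hsep ι hιeq hind hb hu ha₀ h0
    exact ⟨ri, hDi, hSi⟩
  choose ri hDi hSi using hmem
  -- `δ_c > 0` and `dim A_c > 0`
  have hδ : ∀ c, 0 < Module.finrank ℚ ↥((𝒟 c).map (LinearMap.applyₗ (a₀ c))) := by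
    intro c
    refine Module.finrank_pos_iff_exists_ne_zero.2 ⟨⟨a₀ c, ?_⟩, fun h1 => h0 c (congrArg Subtype.val h1)⟩
    refine Submodule.mem_map.2 ⟨LinearMap.id, (h𝒟 c _).2 ⟨fun a ha => ha, fun k a _ => rfl⟩, rfl⟩
  have hd : ∀ c, 0 < Module.finrank ℚ (Ar c) := fun c =>
    Module.finrank_pos_iff_exists_ne_zero.2 ⟨⟨a₀ c, ha₀ c⟩, fun h1 => h0 c (congrArg Subtype.val h1)⟩
  -- sub-additivity of the D-rank: `r_c·δ_c = dim ⨆_i X_i ≤ Σ_i dim X_i = (Σ_i r^i_c)·δ_c`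
  have hsub : ∀ c, r c ≤ ∑ i, ri i c := by
    intro c
    have h1 : Module.finrank ℚ ↥(⨆ i, ⨆ j, (𝒟 c).map (LinearMap.applyₗ (b i c j))) ≤
        ∑ i, Module.finrank ℚ ↥(⨆ j, (𝒟 c).map (LinearMap.applyₗ (b i c j))) :=
      finrank_iSup_le_sum_finrank_of_finite _
    rw [hD c, Finset.sum_congr rfl fun i _ => hDi i c, ← Finset.sum_mul] at h1
    exact Nat.le_of_mul_le_mul_right h1 (hδ c)
  refine ⟨n, fun c => Module.finrank ℚ (Ar c), r, ri, hd, hsub, hS, hSi, ?_⟩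
  -- bookkeeping: `Σ_i (Σ_c r^i_c d_c + 1) + 1 = (Σ_c r_c d_c + 1) + |I| + Σ_c (Σ_i r^i_c − r_c) d_c`
  rw [hS, Finset.sum_congr rfl fun i _ => hSi i, Finset.sum_add_distrib, Finset.sum_const, Finset.card_univ,
    smul_eq_mul, mul_one, Finset.sum_comm]
  have hsplit : ∀ c, (∑ i, ri i c * Module.finrank ℚ (Ar c)) =
      r c * Module.finrank ℚ (Ar c) + ((∑ i, ri i c) - r c) * Module.finrank ℚ (Ar c) := fun c => by
    rw [← Finset.sum_mul, ← add_mul, Nat.add_sub_cancel' (hsub c)]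
  rw [Finset.sum_congr rfl fun c _ => hsplit c, Finset.sum_add_distrib]
  ring

end Summit.HodgeConjecture.CorCM.IrrOdd

/-! ### §4 Products of CM abelian varieties -/

namespace Summit.HodgeConjecture.CorCM

open CategoryTheory CategoryTheory.Limits NumberField Module IntermediateField
open Literature.NumberTheory.ComplexMultiplication
open Literature.AlgebraicGeometry.Motives (AbelianVariety CMType)
open Literature.AlgebraicGeometry.Motives.AbelianVariety
open Literature.AlgebraicGeometry.HodgeTheory
open Literature.AlgebraicGeometry.ComplexMultiplication (IsCMTypeRealisation)
open Literature.AlgebraicGeometry.Pohlmann1968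

variable {I : Type} [Fintype I] {K : I → Type} [∀ i, Field (K i)] [∀ i, NumberField (K i)] [∀ i, IsCMField (K i)]

/-- **`dim MT(∏_i A_i)` AND `dim MT(A_i)` AS SUB-SUMS OF THE ISOTYPIC DIMENSION COUNT OF `⊕_i ℚ^{Hom(K_i, ℂ)}`.**
For CM fields `K_i` and CM types `Φ_i` (`i ∈ I` finite, non-empty) there are pairwise non-embeddable `Aut(ℂ)`-stable
irreducible non-zero `A_c ≤ ℚ^{⊔_i Hom(K_i, ℂ)}` (`c ∈ Fin n`) and multiplicities `m_{i,c}` with equivariant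
embeddings injective on `A_c` whose images are independent and span `ℚ^{Hom(K_i, ℂ)}` — so **`[K_i : ℚ] =
|Hom(K_i, ℂ)| = Σ_c m_{i,c}·dim A_c`** — and integers **`r_c ≤ Σ_i m_{i,c}`, `r^i_c ≤ m_{i,c}`** with
**`cmFamilyRank Φ = Σ_c r_c·dim A_c + 1`** (`dim Hg(∏_i A_i) = Σ_c r_c·dim A_c`) and **`cmTypeRank Φ_i =
Σ_c r^i_c·dim A_c + 1`** (`dim Hg(A_i) = Σ_c r^i_c·dim A_c`). [cite: Deligne1982HodgeCycles, I.3.4, I.5 (p. 53) and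
I Ex. 3.7 (c)] [cite: Serre1977, §2.6] [cite: Mai1989, §2 Prop. 1 (proof)] -/
theorem exists_constituents_cmFamilyRank_eq_sum [Nonempty I] (Φ : ∀ i, CMType (K i)) :
    ∃ (n : ℕ) (Ar : Fin n → Submodule ℚ ((Σ i, (K i →+* ℂ)) → ℚ)) (m : I → Fin n → ℕ)
      (ι : ∀ (i : I) (c : Fin n), Fin (m i c) → (((Σ i, (K i →+* ℂ)) → ℚ) →ₗ[ℚ] ((K i →+* ℂ) → ℚ)))
      (r : Fin n → ℕ) (ri : I → Fin n → ℕ),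
      (∀ (c : Fin n) (k : ℂ ≃+* ℂ) (a : (Σ i, (K i →+* ℂ)) → ℚ), a ∈ Ar c → (fun x => a (k • x)) ∈ Ar c) ∧
      (∀ (c : Fin n) (W : Submodule ℚ ((Σ i, (K i →+* ℂ)) → ℚ)), W ≤ Ar c → W ≠ ⊥ →
        (∀ (k : ℂ ≃+* ℂ) (f : (Σ i, (K i →+* ℂ)) → ℚ), f ∈ W → (fun x => f (k • x)) ∈ W) → W = Ar c) ∧
      (∀ c : Fin n, Ar c ≠ ⊥) ∧
      (∀ (c c' : Fin n) (L : ((Σ i, (K i →+* ℂ)) → ℚ) →ₗ[ℚ] ((Σ i, (K i →+* ℂ)) → ℚ)), c ≠ c' → Ar c ≠ ⊥ →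
        (∀ a ∈ Ar c, L a ∈ Ar c') → (∀ a ∈ Ar c, L a = 0 → a = 0) →
        (∀ (k : ℂ ≃+* ℂ) (a : (Σ i, (K i →+* ℂ)) → ℚ), a ∈ Ar c →
          L (fun x => a (k • x)) = fun x => L a (k • x)) → False) ∧
      (∀ (i : I) (c : Fin n) (j : Fin (m i c)) (k : ℂ ≃+* ℂ) (a : (Σ i, (K i →+* ℂ)) → ℚ), a ∈ Ar c →
        ι i c j (fun x => a (k • x)) = fun s => ι i c j a (k • s)) ∧
      (∀ (i : I) (c : Fin n) (j : Fin (m i c)) (a : (Σ i, (K i →+* ℂ)) → ℚ), a ∈ Ar c →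
        ι i c j a = 0 → a = 0) ∧
      (∀ i : I, iSupIndep fun q : (Σ c : Fin n, Fin (m i c)) => (Ar q.1).map (ι i q.1 q.2)) ∧
      (∀ i : I, (⨆ c : Fin n, ⨆ j : Fin (m i c), (Ar c).map (ι i c j)) = ⊤) ∧
      (∀ i : I, Fintype.card (K i →+* ℂ) = ∑ c, m i c * Module.finrank ℚ (Ar c)) ∧
      (∀ c, r c ≤ ∑ i, m i c) ∧
      CMAlgebra.cmFamilyRank Φ = (∑ c, r c * Module.finrank ℚ (Ar c)) + 1 ∧
      (∀ i c, ri i c ≤ m i c) ∧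
      ∀ i, cmTypeRank (Φ i) = (∑ c, ri i c * Module.finrank ℚ (Ar c)) + 1 := by
  haveI : ∀ i, Nonempty (K i →+* ℂ) := fun i => inferInstance
  exact IrrOdd.exists_constituents_typeRank_eq_sum (G := ℂ ≃+* ℂ) (E := fun i => K i →+* ℂ)
    (Φ := fun i => (Φ i).1) fun i => isCMTypeWith_conj (Φ i)

/-- **THE DEFECT OF A PRODUCT OF CM ABELIAN VARIETIES IS A COMBINATION OF CONSTITUENT DIMENSIONS**:
`Σ_i dim MT(A_i) + 1 = dim MT(∏_i A_i) + |I| + Σ_c (Σ_i r^i_c − r_c)·d_c` with `d_c = dim A_c > 0` the dimensions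
of the pairwise non-isomorphic irreducible constituents, `dim Hg(∏_i A_i) = Σ_c r_c·d_c`, `dim Hg(A_i) =
Σ_c r^i_c·d_c`, `r_c ≤ Σ_i r^i_c` — so `Hg(∏_i A_i) = ∏_i Hg(A_i)` iff `r_c = Σ_i r^i_c` for every class.
[cite: Deligne1982HodgeCycles, I.5 (p. 53)] [cite: Lang2002, XVII §3] -/
theorem exists_constituents_cmDefect_eq_sum [Nonempty I] (Φ : ∀ i, CMType (K i)) :
    ∃ (n : ℕ) (d : Fin n → ℕ) (r : Fin n → ℕ) (ri : I → Fin n → ℕ),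
      (∀ c, 0 < d c) ∧ (∀ c, r c ≤ ∑ i, ri i c) ∧
      CMAlgebra.cmFamilyRank Φ = (∑ c, r c * d c) + 1 ∧
      (∀ i, cmTypeRank (Φ i) = (∑ c, ri i c * d c) + 1) ∧
      (∑ i, cmTypeRank (Φ i)) + 1 = CMAlgebra.cmFamilyRank Φ + Fintype.card I +
        ∑ c, ((∑ i, ri i c) - r c) * d c := by
  haveI : ∀ i, Nonempty (K i →+* ℂ) := fun i => inferInstance
  exact IrrOdd.exists_constituents_defect_eq_sum (G := ℂ ≃+* ℂ) (E := fun i => K i →+* ℂ)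
    (Φ := fun i => (Φ i).1) fun i => isCMTypeWith_conj (Φ i)

end Summit.HodgeConjecture.CorCM

end
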